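import Summits.HubbardSuperconductivity.HubbardSuperconductivity.Theorems.WidthHaldaneTubeKinematics
import Summits.HubbardSuperconductivity.HubbardSuperconductivity.Theorems.WidthHaldaneTubeStepGauge
import Literature.MathematicalPhysics.QuantumLattice.MagneticHubbardTorusGauge

/-!
# Gauge additivity of twists on the Hubbard tube: relocating the flux, the flux quantum, two-cut cancellation

Support file for the cruxes stated over `WidthHaldaneDefs` (routes `WidthHaldane`, `SeamInduction`;
items stmt-HubbardSuperconductivity-16311/16312/18509/18510). With the column step gauge of
`WidthHaldaneTubeStepGauge` (`L ≥ 3`, cut column `k ≠ 0`) — all PROVED, no definitions, no named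
facts:

* `expect_stepGauge_conj` — in every vector, `⟨ψ, W_g (H₀ + Tw_{θ+θ'}) W_gᴴ ψ⟩ =
  ⟨ψ, (H₀ + Tw_θ + Tw^{cut k}_{θ'}) ψ⟩`, where `Tw^{cut k}_{θ'}` is the `θ'` Peierls twist on the `M`
  bonds `(k-1,b) — (k,b)` (written out as the explicit sum; no new definition);
* `minEnergyOn_seam_add_cut` — GAUGE ADDITIVITY: in every sector `(N, S^z = 0)` the tube with seam
  flux `θ` plus a cut twist `θ'` has the lowest energy `E_{L,M}(U; θ + θ', N)` — only the total flux
  through the long cycle is gauge invariant;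
* `minEnergyOn_cut_eq_tubeEnergy` — RELOCATION: a `θ'` twist at ANY cut gives the sector energies
  `E_{L,M}(U; θ', N)` of the seam twist, so `ρ̃_{L,M}` does not depend on where the flux is inserted;
* `tubeTwist_add_two_pi`, `tubeEnergy_add_two_pi` — the flux quantum `E(θ + 2π) = E(θ)`;
* `minEnergyOn_two_pi_flips` — flipping the sign of the seam hoppings AND of the hoppings of a
  second cut (`π + π = 2π ≅ 0`) gives back `E(0)`, while either flip alone gives `E(π)`;
  `two_cut_defect_identity` — at any base flux `θ`, `Δ₁₂ - Δ₁ - Δ₂ = -2[E(θ+π) - E(θ)]`: the exact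
  identity behind two-cut / period-halving ("hc/2e") transparency arguments (idea card
  `two-cut-transparency` of the crux `PerWidthThermodynamics`).

References: N. Byers, C. N. Yang, PRL 7 (1961) 46; H. Watanabe, J. Stat. Phys. 177 (2019) 717,
§2.2.3, §4.1; A. Seidel, D.-H. Lee, cond-mat/0402663 (period hc/2e of the flux envelope).
-/

noncomputable section

namespace Summit.HubbardSuperconductivity.HubbardSuperconductivity.Theorems.WidthHaldane

set_option linter.dupNamespace false -- summit = problem name (single-conjunct summit), D-0017

open scoped BigOperators Classical Matrix ComplexConjugate
open Matrix Literature.MathematicalPhysics.QuantumLattice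
open Summit.HubbardSuperconductivity.HubbardSuperconductivity.Theorems.DeformationLadder
  (phaseGauge_conj_hamiltonian expect_phaseGauge_conj_hamiltonian expect_hamiltonian_eq)

section TwoCutAssembly

variable (L M : ℕ) [NeZero L] [NeZero M] (Λ : Type) [LinearOrder Λ] [Fintype Λ]
  (e : Λ ≃ ZMod L × ZMod M)

/-- The expectation of the seam twist: `⟨ψ, Tw_θ ψ⟩ = Σ_{b,σ} (1-e^{iθ}) h_{(0,b),(-1,b)} + (1-e^{-iθ}) h_{(-1,b),(0,b)}`.
[folklore] -/
theorem expect_tubeTwist (θ : ℝ) (ψ : Fock (Orb Λ)) :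
    expect (tubeTwist L M Λ e θ) ψ =
      ∑ b : ZMod M, ∑ σ : Fin 2,
        ((1 - Complex.exp (Complex.I * θ)) *
            expect (creation (orb (e.symm (0, b)) σ) * annihilation (orb (e.symm (-1, b)) σ)) ψ +
          (1 - Complex.exp (-(Complex.I * θ))) *
            expect (creation (orb (e.symm (-1, b)) σ) * annihilation (orb (e.symm (0, b)) σ)) ψ) := by
  unfold tubeTwist
  simp only [expect_sum, expect_add, expect_smul]

omit [NeZero M] [LinearOrder Λ] [Fintype Λ] in
/-- The step gauge takes the value `1` on the column `0` and `e^{iθ'}` on the column `-1`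
(`k ≠ 0`): across the seam, `g_{(0,b)} conj g_{(-1,b)} = e^{-iθ'}`. [folklore] -/
theorem stepGauge_seam {k : ZMod L} (hk : k ≠ 0) (θ' : ℝ) {x y : Λ}
    (h : (e x).1 = 0 ∧ y = e.symm (-1, (e x).2)) :
    ((Circle.exp (θ' * (if k.val ≤ (e x).1.val then 1 else 0)) : ℂ) *
        conj (Circle.exp (θ' * (if k.val ≤ (e y).1.val then 1 else 0)) : ℂ)) =
      Complex.exp (-(Complex.I * θ')) := by
  have hkv : 1 ≤ k.val := by
    rw [Nat.one_le_iff_ne_zero]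
    exact fun h0 => hk ((ZMod.val_eq_zero k).1 h0)
  have hkL : k.val < L := ZMod.val_lt k
  have hLm1 : ((-1 : ZMod L)).val + 1 = L := (zmod_eq_neg_one_iff_val (-1 : ZMod L)).1 rfl
  have hx : ¬ k.val ≤ (e x).1.val := by rw [h.1, ZMod.val_zero]; omega
  have hy : k.val ≤ (e y).1.val := by rw [h.2, Equiv.apply_symm_apply]; dsimp only; omega
  rw [if_neg hx, if_pos hy, Circle.coe_exp, Circle.coe_exp, ← Complex.exp_conj, map_mul, Complex.conj_ofReal,
    Complex.conj_I, ← Complex.exp_add]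
  congr 1
  push_cast
  ring

omit [NeZero M] [LinearOrder Λ] [Fintype Λ] in
/-- Across the seam in the other orientation, `g_{(-1,b)} conj g_{(0,b)} = e^{iθ'}`. [folklore] -/
theorem stepGauge_seam' {k : ZMod L} (hk : k ≠ 0) (θ' : ℝ) {x y : Λ}
    (h : (e y).1 = 0 ∧ x = e.symm (-1, (e y).2)) :
    ((Circle.exp (θ' * (if k.val ≤ (e x).1.val then 1 else 0)) : ℂ) *
        conj (Circle.exp (θ' * (if k.val ≤ (e y).1.val then 1 else 0)) : ℂ)) =
      Complex.exp (Complex.I * θ') := by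
  have hkv : 1 ≤ k.val := by
    rw [Nat.one_le_iff_ne_zero]
    exact fun h0 => hk ((ZMod.val_eq_zero k).1 h0)
  have hkL : k.val < L := ZMod.val_lt k
  have hLm1 : ((-1 : ZMod L)).val + 1 = L := (zmod_eq_neg_one_iff_val (-1 : ZMod L)).1 rfl
  have hy : ¬ k.val ≤ (e y).1.val := by rw [h.1, ZMod.val_zero]; omega
  have hx : k.val ≤ (e x).1.val := by rw [h.2, Equiv.apply_symm_apply]; dsimp only; omega
  rw [if_pos hx, if_neg hy, Circle.coe_exp, Circle.coe_exp, ← Complex.exp_conj, map_mul, Complex.conj_ofReal,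
    Complex.conj_I, ← Complex.exp_add]
  congr 1
  push_cast
  ring

omit [NeZero L] [NeZero M] [LinearOrder Λ] [Fintype Λ] in
/-- A seam pair `x = (0,b)`, `y = (-1,b)` is adjacent, and is neither a reversed seam pair nor a cut
pair (`k ≠ 0`, `L ≥ 3`). [folklore] -/
theorem seam_pair_facts (hL : 3 ≤ L) {k : ZMod L} (hk : k ≠ 0) {x y : Λ}
    (h : (e x).1 = 0 ∧ y = e.symm (-1, (e x).2)) :
    (tubeGraph e).Adj x y ∧ ¬ ((e y).1 = 0 ∧ x = e.symm (-1, (e y).2)) ∧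
      ¬ ((e x).1 = k ∧ y = e.symm (k - 1, (e x).2)) ∧ ¬ ((e y).1 = k ∧ x = e.symm (k - 1, (e y).2)) := by
  haveI : Fact (1 < L) := ⟨by omega⟩
  obtain ⟨hx0, hy⟩ := h
  have hey : e y = (-1, (e x).2) := by rw [hy, Equiv.apply_symm_apply]
  refine ⟨⟨fun hxy => ?_, Or.inr (Or.inl ?_)⟩, ?_, ?_, ?_⟩
  · have h1 := congrArg (fun z => (e z).1) hxy
    simp only [hey, hx0] at h1
    exact one_ne_zero (neg_eq_zero.1 h1.symm)
  · rw [Equiv.eq_symm_apply, hey, Prod.ext_iff]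
    exact ⟨by rw [hx0, neg_add_cancel], rfl⟩
  · rintro ⟨h0, -⟩
    rw [hey] at h0
    exact one_ne_zero (neg_eq_zero.1 h0)
  · rintro ⟨hxk, -⟩
    exact hk (hxk ▸ hx0)
  · rintro ⟨hyk, hxk⟩
    rw [hey] at hyk
    have hex : (e x).1 = k - 1 := by
      have := congrArg (fun z => (e z).1) hxk
      simpa using this
    apply two_ne_zero_zmod L hL
    rw [hx0] at hex
    linear_combination hex - hyk

omit [NeZero L] [NeZero M] [LinearOrder Λ] [Fintype Λ] in
/-- The reversed statement for a reversed seam pair. [folklore] -/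
theorem seam_pair_facts' (hL : 3 ≤ L) {k : ZMod L} (hk : k ≠ 0) {x y : Λ}
    (h : (e y).1 = 0 ∧ x = e.symm (-1, (e y).2)) :
    (tubeGraph e).Adj x y ∧ ¬ ((e x).1 = 0 ∧ y = e.symm (-1, (e x).2)) ∧
      ¬ ((e x).1 = k ∧ y = e.symm (k - 1, (e x).2)) ∧ ¬ ((e y).1 = k ∧ x = e.symm (k - 1, (e y).2)) := by
  obtain ⟨hadj, h1, h2, h3⟩ := seam_pair_facts L M Λ e hL hk (x := y) (y := x) h
  exact ⟨hadj.symm, h1, h3, h2⟩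

/-- **Gauge additivity of twists, in expectation** (`L ≥ 3`, cut column `k ≠ 0`): conjugating the
tube carrying the seam flux `θ + θ'` by the column step gauge of height `θ'` at the cut `k` yields,
in every vector, the expectation of the tube carrying the seam flux `θ` AND a `θ'` twist on the `M`
bonds of the cut `(k-1 | k)`. [cite: Watanabe2019, §2.2.3 and §4.1] -/
theorem expect_stepGauge_conj (hL : 3 ≤ L) {k : ZMod L} (hk : k ≠ 0) (U θ θ' : ℝ) (ψ : Fock (Orb Λ)) :
    expect (phaseGauge (fun z : Λ => Circle.exp (θ' * (if k.val ≤ (e z).1.val then 1 else 0))) *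
        (tubeH0 L M Λ e U + tubeTwist L M Λ e (θ + θ')) *
        (phaseGauge (fun z : Λ => Circle.exp (θ' * (if k.val ≤ (e z).1.val then 1 else 0))))ᴴ) ψ =
      expect (tubeH0 L M Λ e U + tubeTwist L M Λ e θ +
        ∑ b : ZMod M, ∑ σ : Fin 2,
          ((1 - Complex.exp (Complex.I * θ')) •
              (creation (orb (e.symm (k, b)) σ) * annihilation (orb (e.symm (k - 1, b)) σ)) +
            (1 - Complex.exp (-(Complex.I * θ'))) •
              (creation (orb (e.symm (k - 1, b)) σ) * annihilation (orb (e.symm (k, b)) σ)))) ψ := by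
  -- expand both sides into sums of hopping amplitudes
  rw [Matrix.mul_add, Matrix.add_mul, expect_add, expect_add, expect_add, tubeH0_eq,
    expect_phaseGauge_conj_hamiltonian, expect_hamiltonian_eq, expect_phaseGauge_conj_tubeTwist,
    expect_tubeTwist]
  simp only [expect_sum, expect_add, expect_smul, Finset.sum_add_distrib]
  -- all seam / cut sums as guarded double sums over ordered pairs
  rw [sum_seam_eq_sum_sum L M Λ e (fun x y => ∑ σ : Fin 2, (1 - Complex.exp (Complex.I * ↑(θ + θ'))) *
      (((Circle.exp (θ' * (if k.val ≤ (e x).1.val then 1 else 0)) : ℂ) *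
        conj (Circle.exp (θ' * (if k.val ≤ (e y).1.val then 1 else 0)) : ℂ)) *
        expect (creation (orb x σ) * annihilation (orb y σ)) ψ)),
    sum_seam_eq_sum_sum' L M Λ e (fun x y => ∑ σ : Fin 2, (1 - Complex.exp (-(Complex.I * ↑(θ + θ')))) *
      (((Circle.exp (θ' * (if k.val ≤ (e x).1.val then 1 else 0)) : ℂ) *
        conj (Circle.exp (θ' * (if k.val ≤ (e y).1.val then 1 else 0)) : ℂ)) *
        expect (creation (orb x σ) * annihilation (orb y σ)) ψ)),
    sum_seam_eq_sum_sum L M Λ e (fun x y => ∑ σ : Fin 2, (1 - Complex.exp (Complex.I * θ)) *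
      expect (creation (orb x σ) * annihilation (orb y σ)) ψ),
    sum_seam_eq_sum_sum' L M Λ e (fun x y => ∑ σ : Fin 2, (1 - Complex.exp (-(Complex.I * θ))) *
      expect (creation (orb x σ) * annihilation (orb y σ)) ψ),
    sum_cols_eq_sum_sum L M Λ e k (k - 1) (fun x y => ∑ σ : Fin 2, (1 - Complex.exp (Complex.I * θ')) *
      expect (creation (orb x σ) * annihilation (orb y σ)) ψ),
    sum_cols_eq_sum_sum' L M Λ e k (k - 1) (fun x y => ∑ σ : Fin 2, (1 - Complex.exp (-(Complex.I * θ'))) *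
      expect (creation (orb x σ) * annihilation (orb y σ)) ψ)]
  simp only [ite_sum_fin_two]
  rw [Complex.ofReal_one, neg_one_mul, neg_one_mul]
  -- move the interaction terms out of the way
  rw [show ∀ (A B C T : ℂ), -A + T + (B + C) = T + (-A + B + C) from fun A B C T => by ring,
    show ∀ (A B C D F T : ℂ), -A + T + (B + C) + (D + F) = T + (-A + B + C + D + F) from
      fun A B C D F T => by ring, add_right_inj]
  simp only [← Finset.sum_neg_distrib, ← Finset.sum_add_distrib]
  refine Finset.sum_congr rfl fun x _ => Finset.sum_congr rfl fun y _ => Finset.sum_congr rfl fun σ _ => ?_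
  by_cases hsp : (e x).1 = 0 ∧ y = e.symm (-1, (e x).2)
  · obtain ⟨hadj, hsm, hc1, hc2⟩ := seam_pair_facts L M Λ e hL hk hsp
    rw [stepGauge_seam L M Λ e hk θ' hsp]
    simp only [if_pos hadj, if_pos hsp, if_neg hsm, if_neg hc1, if_neg hc2]
    have hz : Complex.exp (Complex.I * ↑(θ + θ')) * Complex.exp (-(Complex.I * θ')) =
        Complex.exp (Complex.I * θ) := by
      rw [← Complex.exp_add]; congr 1; push_cast; ring
    linear_combination (-(expect (creation (orb x σ) * annihilation (orb y σ)) ψ)) * hz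
  · by_cases hsm : (e y).1 = 0 ∧ x = e.symm (-1, (e y).2)
    · obtain ⟨hadj, -, hc1, hc2⟩ := seam_pair_facts' L M Λ e hL hk hsm
      rw [stepGauge_seam' L M Λ e hk θ' hsm]
      simp only [if_pos hadj, if_pos hsm, if_neg hsp, if_neg hc1, if_neg hc2]
      have hz : Complex.exp (-(Complex.I * ↑(θ + θ'))) * Complex.exp (Complex.I * θ') =
          Complex.exp (-(Complex.I * θ)) := by
        rw [← Complex.exp_add]; congr 1; push_cast; ring
      linear_combination (-(expect (creation (orb x σ) * annihilation (orb y σ)) ψ)) * hz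
    · have key := stepGauge_pointwise L M Λ e hL hk θ' x y
      rw [if_neg hsp, if_neg hsm] at key
      simp only [if_neg hsp, if_neg hsm]
      split_ifs at key ⊢ <;>
        linear_combination (expect (creation (orb x σ) * annihilation (orb y σ)) ψ) * key

end TwoCutAssembly

section TwoCutEnergies

variable (L M : ℕ) [NeZero L] [NeZero M] (Λ : Type) [LinearOrder Λ] [Fintype Λ]
  (e : Λ ≃ ZMod L × ZMod M)

omit [NeZero L] [NeZero M] [LinearOrder Λ] in
/-- Two operators with the same expectation in every vector have the same sector energies (the
Rayleigh sets coincide). [folklore] -/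
theorem minEnergyOn_congr_of_expect {A B : Matrix (Finset (Orb Λ)) (Finset (Orb Λ)) ℂ}
    (K : Submodule ℂ (Fock (Orb Λ))) (h : ∀ ψ, expect A ψ = expect B ψ) :
    A.minEnergyOn K = B.minEnergyOn K := by
  have h' : ∀ ψ : Fock (Orb Λ), star ψ ⬝ᵥ A *ᵥ ψ = star ψ ⬝ᵥ B *ᵥ ψ := h
  unfold Matrix.minEnergyOn
  simp only [h']

/-- **Gauge additivity of twists** (`L ≥ 3`, cut column `k ≠ 0`): the tube carrying the seam flux
`θ` AND a `θ'` Peierls twist on the `M` bonds of the cut `(k-1 | k)` has, in every sector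
`(N, S^z = 0)`, the same lowest energy as the tube carrying the seam flux `θ + θ'` — only the total
flux through the long cycle is gauge invariant (Byers–Yang; Watanabe 2019 §2.2.3). This is the
`GaugeAdditivity` / cut-relocation identity behind two-cut arguments. [cite: Watanabe2019, §2.2.3 and §4.1] -/
theorem minEnergyOn_seam_add_cut (hL : 3 ≤ L) {k : ZMod L} (hk : k ≠ 0) (U θ θ' : ℝ) (N : ℕ) :
    (tubeH0 L M Λ e U + tubeTwist L M Λ e θ +
        ∑ b : ZMod M, ∑ σ : Fin 2,
          ((1 - Complex.exp (Complex.I * θ')) •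
              (creation (orb (e.symm (k, b)) σ) * annihilation (orb (e.symm (k - 1, b)) σ)) +
            (1 - Complex.exp (-(Complex.I * θ'))) •
              (creation (orb (e.symm (k - 1, b)) σ) * annihilation (orb (e.symm (k, b)) σ)))).minEnergyOn
        (szSector N 0) =
      tubeEnergy L M Λ e U (θ + θ') N := by
  set g : Λ → Circle := fun z : Λ => Circle.exp (θ' * (if k.val ≤ (e z).1.val then 1 else 0)) with hg
  have hunit := minEnergyOn_szSector_phaseGauge_conj g⁻¹ (tubeH0 L M Λ e U + tubeTwist L M Λ e (θ + θ')) N 0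
  rw [phaseGauge_conjTranspose, inv_inv, ← phaseGauge_conjTranspose g] at hunit
  rw [tubeEnergy_eq, ← hunit]
  symm
  exact minEnergyOn_congr_of_expect Λ _ fun ψ => expect_stepGauge_conj L M Λ e hL hk U θ θ' ψ

/-- **Relocating the twist** (`L ≥ 3`, `k ≠ 0`): a `θ'` twist on the bonds of ANY cut `(k-1 | k)`
gives the same sector energies as the seam twist `tubeTwist θ'`; in particular the stiffness
functional `ρ̃_{L,M}` does not depend on where along the tube the flux is inserted.
[cite: Watanabe2019, §2.2.3 and §4.1] -/
theorem minEnergyOn_cut_eq_tubeEnergy (hL : 3 ≤ L) {k : ZMod L} (hk : k ≠ 0) (U θ' : ℝ) (N : ℕ) :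
    (tubeH0 L M Λ e U +
        ∑ b : ZMod M, ∑ σ : Fin 2,
          ((1 - Complex.exp (Complex.I * θ')) •
              (creation (orb (e.symm (k, b)) σ) * annihilation (orb (e.symm (k - 1, b)) σ)) +
            (1 - Complex.exp (-(Complex.I * θ'))) •
              (creation (orb (e.symm (k - 1, b)) σ) * annihilation (orb (e.symm (k, b)) σ)))).minEnergyOn
        (szSector N 0) =
      tubeEnergy L M Λ e U θ' N := by
  have h := minEnergyOn_seam_add_cut L M Λ e hL hk U 0 θ' N
  rwa [tubeTwist_zero, add_zero, zero_add] at h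

/-- The seam twist is `2π`-periodic in the flux. [folklore] -/
theorem tubeTwist_add_two_pi (θ : ℝ) : tubeTwist L M Λ e (θ + 2 * Real.pi) = tubeTwist L M Λ e θ := by
  have h1 : Complex.exp (Complex.I * ((θ + 2 * Real.pi : ℝ) : ℂ)) = Complex.exp (Complex.I * θ) := by
    rw [show Complex.I * ((θ + 2 * Real.pi : ℝ) : ℂ) = Complex.I * θ + 2 * Real.pi * Complex.I by
      push_cast; ring, Complex.exp_add, Complex.exp_two_pi_mul_I, mul_one]
  have h2 : Complex.exp (-(Complex.I * ((θ + 2 * Real.pi : ℝ) : ℂ))) = Complex.exp (-(Complex.I * θ)) := by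
    rw [show -(Complex.I * ((θ + 2 * Real.pi : ℝ) : ℂ)) = -(Complex.I * θ) + -(2 * Real.pi * Complex.I) by
      push_cast; ring, Complex.exp_add, Complex.exp_neg (2 * Real.pi * Complex.I), Complex.exp_two_pi_mul_I,
      inv_one, mul_one]
  unfold tubeTwist
  simp only [h1, h2]

/-- **Flux quantum**: the twisted sector energies are `2π`-periodic, `E(θ + 2π) = E(θ)` (Byers–Yang 1961).
[cite: ByersYang1961, p. 46] -/
theorem tubeEnergy_add_two_pi (U θ : ℝ) (N : ℕ) :
    tubeEnergy L M Λ e U (θ + 2 * Real.pi) N = tubeEnergy L M Λ e U θ N := by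
  rw [tubeEnergy_eq, tubeEnergy_eq, tubeTwist_add_two_pi]

/-- **Two sign-flip defects cancel** (`L ≥ 3`, `k ≠ 0`): flipping the sign of the `M` seam hoppings
(flux `π`) AND of the `M` hoppings of the cut `(k-1 | k)` (another `π`) is a pure gauge — the sector
energies are those of the untwisted tube, `E(2π) = E(0)`; flipping either one alone gives `E(π)`
(`minEnergyOn_cut_eq_tubeEnergy`). The exact identity behind "two-cut" transparency arguments.
[cite: ByersYang1961, p. 46] -/
theorem minEnergyOn_two_pi_flips (hL : 3 ≤ L) {k : ZMod L} (hk : k ≠ 0) (U : ℝ) (N : ℕ) :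
    (tubeH0 L M Λ e U + tubeTwist L M Λ e Real.pi +
        ∑ b : ZMod M, ∑ σ : Fin 2,
          ((1 - Complex.exp (Complex.I * (Real.pi : ℝ))) •
              (creation (orb (e.symm (k, b)) σ) * annihilation (orb (e.symm (k - 1, b)) σ)) +
            (1 - Complex.exp (-(Complex.I * (Real.pi : ℝ)))) •
              (creation (orb (e.symm (k - 1, b)) σ) * annihilation (orb (e.symm (k, b)) σ)))).minEnergyOn
        (szSector N 0) =
      tubeEnergy L M Λ e U 0 N := by
  rw [minEnergyOn_seam_add_cut L M Λ e hL hk U Real.pi Real.pi N, show Real.pi + Real.pi = 0 + 2 * Real.pi by ring,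
    tubeEnergy_add_two_pi]

/-- **The two-cut defect identity** of the idea card `two-cut-transparency` (`L ≥ 3`, `k ≠ 0`), at an
arbitrary base flux `θ`: with `Δ₁ = E(θ+π) - E(θ)` (sign flip of the seam bonds), `Δ₂` = the shift
caused by flipping the bonds of the cut `k` (equal to `Δ₁` by relocation) and `Δ₁₂` = the shift
caused by both flips (zero: flux `2π`), one has `Δ₁₂ - Δ₁ - Δ₂ = -2[E(θ+π) - E(θ)]`. Stated with the
three sector minima written out. [cite: ByersYang1961, p. 46] -/
theorem two_cut_defect_identity (hL : 3 ≤ L) {k : ZMod L} (hk : k ≠ 0) (U θ : ℝ) (N : ℕ) :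
    ((tubeH0 L M Λ e U + tubeTwist L M Λ e (θ + Real.pi) +
        ∑ b : ZMod M, ∑ σ : Fin 2,
          ((1 - Complex.exp (Complex.I * (Real.pi : ℝ))) •
              (creation (orb (e.symm (k, b)) σ) * annihilation (orb (e.symm (k - 1, b)) σ)) +
            (1 - Complex.exp (-(Complex.I * (Real.pi : ℝ)))) •
              (creation (orb (e.symm (k - 1, b)) σ) * annihilation (orb (e.symm (k, b)) σ)))).minEnergyOn
          (szSector N 0) - tubeEnergy L M Λ e U θ N) -
      (tubeEnergy L M Λ e U (θ + Real.pi) N - tubeEnergy L M Λ e U θ N) -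
      ((tubeH0 L M Λ e U + tubeTwist L M Λ e θ +
        ∑ b : ZMod M, ∑ σ : Fin 2,
          ((1 - Complex.exp (Complex.I * (Real.pi : ℝ))) •
              (creation (orb (e.symm (k, b)) σ) * annihilation (orb (e.symm (k - 1, b)) σ)) +
            (1 - Complex.exp (-(Complex.I * (Real.pi : ℝ)))) •
              (creation (orb (e.symm (k - 1, b)) σ) * annihilation (orb (e.symm (k, b)) σ)))).minEnergyOn
          (szSector N 0) - tubeEnergy L M Λ e U θ N) =
      -2 * (tubeEnergy L M Λ e U (θ + Real.pi) N - tubeEnergy L M Λ e U θ N) := by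
  rw [minEnergyOn_seam_add_cut L M Λ e hL hk U (θ + Real.pi) Real.pi N,
    minEnergyOn_seam_add_cut L M Λ e hL hk U θ Real.pi N,
    show θ + Real.pi + Real.pi = θ + 2 * Real.pi by ring, tubeEnergy_add_two_pi]
  ring

end TwoCutEnergies

end Summit.HubbardSuperconductivity.HubbardSuperconductivity.Theorems.WidthHaldane

end
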